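import Summits.Ventures.HodgeRepro2.T5HeckeConvolution

/-!
# `(k[G/K]^K, conv)` is the algebra `H(G, K)`

`T5HeckeConvolution` transports the product of `H(G, K) = End_G(k[G/K])` to the counting
convolution `conv` on `k[G/K]^K`.  This file records the algebra laws of `conv` — bilinearity
(for all of `k[G/K]`, no invariance needed), associativity on `K`-invariant vectors (through the
associativity of composition), the unit `δ_K` — and the statement that the linear equivalence
`H(G, K) ≃ k[G/K]^K` of `T5HeckePermutationModule` is multiplicative in both directions.  Together
with `T5HeckeDoubleCosetBasis` (the double cosets are a basis) this is the printed description
`H(G, K) = C_c(K∖G/K)` with the convolution product, normalised by `vol(K) = 1`, as an algebra.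
-/

namespace Summit.Ventures.HodgeRepro2.T5HeckeConvolutionAlgebra

open T5HeckePermutationModule T5HeckeConvolution LevelPositivity

variable {G : Type*} [Group G] {k : Type*} [Field k] {K : Subgroup G}

/-- `conv` is additive in its first argument. -/
theorem conv_add_left (t₁ t₂ s : MonoidAlgebra k (G ⧸ K)) :
    conv (t₁ + t₂) s = conv t₁ s + conv t₂ s := by
  unfold conv
  rw [← Finsupp.sum_add]
  refine Finsupp.sum_congr fun x _ => ?_
  rw [map_add, smul_add]

/-- `conv` is additive in its second argument. -/
theorem conv_add_right (t s₁ s₂ : MonoidAlgebra k (G ⧸ K)) :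
    conv t (s₁ + s₂) = conv t s₁ + conv t s₂ := by
  unfold conv
  rw [MonoidAlgebra.coeff_add]
  exact Finsupp.sum_add_index' (fun x => zero_smul k _) (fun x a b => add_smul a b _)

/-- `conv` is `k`-linear in its first argument. -/
theorem conv_smul_left (c : k) (t s : MonoidAlgebra k (G ⧸ K)) :
    conv (c • t) s = c • conv t s := by
  unfold conv
  rw [Finsupp.smul_sum]
  refine Finsupp.sum_congr fun x _ => ?_
  rw [map_smul, smul_comm]

/-- `conv` is `k`-linear in its second argument. -/
theorem conv_smul_right (c : k) (t s : MonoidAlgebra k (G ⧸ K)) :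
    conv t (c • s) = c • conv t s := by
  unfold conv
  rw [MonoidAlgebra.coeff_smul, Finsupp.smul_sum, Finsupp.sum_smul_index']
  · refine Finsupp.sum_congr fun x _ => ?_
    rw [smul_eq_mul, mul_smul]
  · intro x
    rw [zero_smul]

/-- `conv t 0 = 0`. -/
theorem conv_zero_right (t : MonoidAlgebra k (G ⧸ K)) : conv t 0 = 0 := by
  unfold conv
  rw [MonoidAlgebra.coeff_zero, Finsupp.sum_zero_index]

/-- `conv 0 s = 0`. -/
theorem conv_zero_left (s : MonoidAlgebra k (G ⧸ K)) : conv 0 s = 0 := by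
  unfold conv
  simp only [map_zero, smul_zero, Finsupp.sum_fun_zero]

/-- The value at `δ_K` of the element of `H(G, K)` attached to a `K`-invariant vector `t`
(the inverse of `heckeAlgebraEquivInvariants`) is `t` itself. -/
theorem coe_heckeAlgebraEquivInvariants_symm_apply_single_one {t : MonoidAlgebra k (G ⧸ K)}
    (ht : t ∈ invariants (Representation.ofMulAction k G (G ⧸ K)) K) :
    ((heckeAlgebraEquivInvariants.symm ⟨t, ht⟩ : heckeAlgebra k K) :
        Module.End k (MonoidAlgebra k (G ⧸ K)))
      (MonoidAlgebra.single ((1 : G) : G ⧸ K) (1 : k)) = t := by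
  rw [← heckeAlgebraEquivInvariants_apply, LinearEquiv.apply_symm_apply]

/-- The inverse of `heckeAlgebraEquivInvariants` is multiplicative: the element attached to
`conv t s` is the product of the elements attached to `t` and `s`. -/
theorem heckeAlgebraEquivInvariants_symm_conv {t s : MonoidAlgebra k (G ⧸ K)}
    (ht : t ∈ invariants (Representation.ofMulAction k G (G ⧸ K)) K)
    (hs : s ∈ invariants (Representation.ofMulAction k G (G ⧸ K)) K) :
    heckeAlgebraEquivInvariants.symm ⟨conv t s, conv_mem_invariants ht hs⟩ =
      heckeAlgebraEquivInvariants.symm ⟨t, ht⟩ * heckeAlgebraEquivInvariants.symm ⟨s, hs⟩ := by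
  apply heckeAlgebraEquivInvariants.injective
  apply Subtype.ext
  rw [LinearEquiv.apply_symm_apply, coe_heckeAlgebraEquivInvariants_mul, LinearEquiv.apply_symm_apply,
    LinearEquiv.apply_symm_apply]

/-- ASSOCIATIVITY of the convolution on `K`-invariant vectors (the associativity of composition
in `H(G, K)`). -/
theorem conv_assoc {t s r : MonoidAlgebra k (G ⧸ K)}
    (ht : t ∈ invariants (Representation.ofMulAction k G (G ⧸ K)) K)
    (hs : s ∈ invariants (Representation.ofMulAction k G (G ⧸ K)) K)
    (hr : r ∈ invariants (Representation.ofMulAction k G (G ⧸ K)) K) :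
    conv (conv t s) r = conv t (conv s r) := by
  have h₁ := coe_heckeAlgebraEquivInvariants_mul
    (heckeAlgebraEquivInvariants.symm ⟨t, ht⟩ * heckeAlgebraEquivInvariants.symm ⟨s, hs⟩)
    (heckeAlgebraEquivInvariants.symm ⟨r, hr⟩)
  have h₂ := coe_heckeAlgebraEquivInvariants_mul
    (heckeAlgebraEquivInvariants.symm ⟨t, ht⟩)
    (heckeAlgebraEquivInvariants.symm ⟨s, hs⟩ * heckeAlgebraEquivInvariants.symm ⟨r, hr⟩)
  rw [← heckeAlgebraEquivInvariants_symm_conv ht hs, LinearEquiv.apply_symm_apply,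
    LinearEquiv.apply_symm_apply] at h₁
  rw [← heckeAlgebraEquivInvariants_symm_conv hs hr, LinearEquiv.apply_symm_apply,
    LinearEquiv.apply_symm_apply] at h₂
  simp only at h₁ h₂
  rw [← h₁, ← h₂, heckeAlgebraEquivInvariants_symm_conv ht hs,
    heckeAlgebraEquivInvariants_symm_conv hs hr, mul_assoc]

/-- The unit of `H(G, K)` is attached to `δ_K`. -/
theorem heckeAlgebraEquivInvariants_one :
    ((heckeAlgebraEquivInvariants (1 : heckeAlgebra k K) :
        invariants (Representation.ofMulAction k G (G ⧸ K)) K) : MonoidAlgebra k (G ⧸ K)) =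
      MonoidAlgebra.single ((1 : G) : G ⧸ K) (1 : k) := by
  rw [heckeAlgebraEquivInvariants_apply, one_apply_single_one]

/-- `δ_K` is `K`-invariant. -/
theorem single_one_mem_invariants :
    MonoidAlgebra.single ((1 : G) : G ⧸ K) (1 : k) ∈
      invariants (Representation.ofMulAction k G (G ⧸ K)) K := by
  rw [← heckeAlgebraEquivInvariants_one]
  exact Subtype.coe_prop _

/-- The element of `H(G, K)` attached to `δ_K` is the unit. -/
theorem heckeAlgebraEquivInvariants_symm_single_one :
    heckeAlgebraEquivInvariants.symm
        ⟨MonoidAlgebra.single ((1 : G) : G ⧸ K) (1 : k), single_one_mem_invariants⟩ =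
      (1 : heckeAlgebra k K) := by
  apply heckeAlgebraEquivInvariants.injective
  apply Subtype.ext
  rw [LinearEquiv.apply_symm_apply, heckeAlgebraEquivInvariants_one]

end Summit.Ventures.HodgeRepro2.T5HeckeConvolutionAlgebra
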